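import Mathlib
import HarnessLib

/-!
# Weight functions: admissibility and normalization (Davis–Rabinowitz 1984, Sect. 1.10)

**Source.** P. J. Davis, P. Rabinowitz, *Methods of Numerical Integration* (2nd ed., Academic Press, 1984),
Sect. 1.10 "Weight Functions" (pp. 21–22 of the 2nd ed. by its table of contents).

**Statement.** One considers `∫ w(x) f(x) dx` with `w` fixed, "usually (but not always) assumed to be nonnegative";
it is often normalized by `∫_a^b w = 1` (1.10.1). The weight `w` is called *admissible* over the finite or infinite
interval `[a, b]` if `w(x) ≥ 0` on `[a, b]`, `∫_a^b w > 0` and `∫_a^b w(x) x^k dx < ∞`, `k = 0, 1, …`. The integral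
`∫ w f` can then be interpreted as a weighted average of `f`. Throughout the book `∫_a^b w < ∞` (1.10.2), which allows
only integrable singularities, "as, for example, `∫_0^1 f(x)/√x dx` where `f` is bounded in the neighborhood of zero".

**What is typed** (all PROVED, Mathlib only; finite intervals, `a ≤ b`):
* `IsAdmissibleWeight w a b` (nonnegative on `[a, b]`, `0 < ∫_a^b w`, every moment `w(x) x^k` interval-integrable) and
  `IsNormalizedWeight w a b` ((1.10.1): `∫_a^b w = 1`);
* `IsAdmissibleWeight.intervalIntegrable` ((1.10.2) is the moment `k = 0`), `IsAdmissibleWeight.integral_pos`;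
* examples: the Legendre weight `w = 1` (`isAdmissibleWeight_one`, normalized form `1/(b − a)`,
  `isNormalizedWeight_const`), any continuous positive weight (`isAdmissibleWeight_of_continuous`), and the book's
  singular example `w(x) = x^{-1/2}` on `[0, 1]` (`isAdmissibleWeight_rpow_neg_half`: `∫_0^1 x^{-1/2} dx = 2`,
  `integral_rpow_neg_half_unit`, moments `∫_0^1 x^{k − 1/2} dx = 1/(k + 1/2)`, `integral_moment_rpow_neg_half`), with the
  normalized version `x^{-1/2}/2` (`isNormalizedWeight_rpow_neg_half_div_two`);
* the weighted-average reading: for a normalized nonnegative weight and `m ≤ f ≤ M` on `[a, b]`,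
  `m ≤ ∫_a^b w f ≤ M` (`weightedAverage_mem_Icc`).

References: [cite: DavisRabinowitz1984, Sect. 1.10 (1.10.1)-(1.10.2)].
-/

noncomputable section

open Real MeasureTheory intervalIntegral Set

namespace Literature.Analysis.Quadrature

/-- An **admissible weight** on `[a, b]` (DR84 Sect. 1.10): `w ≥ 0` on `[a, b]`, `∫_a^b w > 0`, and all moments
`∫_a^b w(x) x^k dx` exist. [cite: DavisRabinowitz1984, Sect. 1.10 (1.10.2)] -/
def IsAdmissibleWeight (w : ℝ → ℝ) (a b : ℝ) : Prop :=
  (∀ x ∈ Icc a b, 0 ≤ w x) ∧ (0 < ∫ x in a..b, w x) ∧ ∀ k : ℕ, IntervalIntegrable (fun x => w x * x ^ k) volume a b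

/-- A **normalized weight** on `[a, b]`: `∫_a^b w = 1` (1.10.1). [cite: DavisRabinowitz1984, Sect. 1.10 (1.10.1)] -/
def IsNormalizedWeight (w : ℝ → ℝ) (a b : ℝ) : Prop :=
  ∫ x in a..b, w x = 1

namespace IsAdmissibleWeight

variable {w : ℝ → ℝ} {a b : ℝ}

/-- (1.10.2): an admissible weight is integrable (`k = 0`). [cite: DavisRabinowitz1984, Sect. 1.10 (1.10.2)] -/
theorem intervalIntegrable (h : IsAdmissibleWeight w a b) : IntervalIntegrable w volume a b := by
  simpa using h.2.2 0

/-- `∫_a^b w > 0`. [cite: DavisRabinowitz1984, Sect. 1.10] -/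
theorem integral_pos (h : IsAdmissibleWeight w a b) : 0 < ∫ x in a..b, w x := h.2.1

/-- `w ≥ 0` on `[a, b]`. [cite: DavisRabinowitz1984, Sect. 1.10] -/
theorem nonneg (h : IsAdmissibleWeight w a b) {x : ℝ} (hx : x ∈ Icc a b) : 0 ≤ w x := h.1 x hx

/-- The moments exist. [cite: DavisRabinowitz1984, Sect. 1.10] -/
theorem moment_intervalIntegrable (h : IsAdmissibleWeight w a b) (k : ℕ) :
    IntervalIntegrable (fun x => w x * x ^ k) volume a b := h.2.2 k

/-- An admissible weight lives on a nondegenerate interval: `a ≠ b`. [cite: DavisRabinowitz1984, Sect. 1.10] -/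
theorem ne (h : IsAdmissibleWeight w a b) : a ≠ b := by
  rintro rfl
  have := h.integral_pos
  simp at this

/-- Dividing by `∫ w` normalizes an admissible weight (1.10.1). [cite: DavisRabinowitz1984, Sect. 1.10 (1.10.1)] -/
theorem normalize (h : IsAdmissibleWeight w a b) :
    IsNormalizedWeight (fun x => w x / ∫ t in a..b, w t) a b := by
  unfold IsNormalizedWeight
  rw [intervalIntegral.integral_div, div_self h.integral_pos.ne']

end IsAdmissibleWeight

/-! ## Examples -/

/-- A continuous weight, nonnegative on `[a, b]` and positive somewhere inside, is admissible (`a < b`).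
[cite: DavisRabinowitz1984, Sect. 1.10] -/
theorem isAdmissibleWeight_of_continuous {w : ℝ → ℝ} {a b : ℝ} (hab : a < b) (hw : Continuous w)
    (h0 : ∀ x ∈ Icc a b, 0 ≤ w x) {c : ℝ} (hc : c ∈ Icc a b) (hwc : 0 < w c) : IsAdmissibleWeight w a b := by
  refine ⟨h0, ?_, fun k => (hw.mul (continuous_pow k)).intervalIntegrable _ _⟩
  exact intervalIntegral.integral_pos hab hw.continuousOn (fun x hx => h0 x (Ioc_subset_Icc_self hx)) ⟨c, hc, hwc⟩

/-- The Legendre weight `w = 1` is admissible on `[a, b]`, `a < b`. [cite: DavisRabinowitz1984, Sect. 1.10] -/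
theorem isAdmissibleWeight_one {a b : ℝ} (hab : a < b) : IsAdmissibleWeight (fun _ => 1) a b :=
  isAdmissibleWeight_of_continuous hab continuous_const (fun _ _ => zero_le_one) (left_mem_Icc.2 hab.le) one_pos

/-- … with `∫_a^b 1 = b − a`, so `1/(b − a)` is its normalized form (1.10.1). [cite: DavisRabinowitz1984, Sect. 1.10 (1.10.1)] -/
theorem isNormalizedWeight_const {a b : ℝ} (hab : a < b) : IsNormalizedWeight (fun _ => 1 / (b - a)) a b := by
  unfold IsNormalizedWeight
  rw [intervalIntegral.integral_const, smul_eq_mul]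
  field_simp [(sub_pos.2 hab).ne']

/-- A weight that vanishes identically is not admissible. [cite: DavisRabinowitz1984, Sect. 1.10] -/
theorem not_isAdmissibleWeight_zero (a b : ℝ) : ¬ IsAdmissibleWeight (fun _ => 0) a b := by
  intro h; have := h.integral_pos; simp at this

/-! ## The singular example `w(x) = x^{-1/2}` on `[0, 1]` -/

/-- `∫_0^1 x^{-1/2} dx = 2`: an integrable singularity (1.10.2). [cite: DavisRabinowitz1984, Sect. 1.10 (1.10.2)] -/
theorem integral_rpow_neg_half_unit : ∫ x in (0 : ℝ)..1, x ^ (-(1 / 2 : ℝ)) = 2 := by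
  rw [integral_rpow (Or.inl (by norm_num))]
  norm_num

/-- The moments of `x^{-1/2}` on `[0, 1]`: `∫_0^1 x^{-1/2} x^k dx = 1/(k + 1/2)`.
[cite: DavisRabinowitz1984, Sect. 1.10 (1.10.2)] -/
theorem integral_moment_rpow_neg_half (k : ℕ) :
    ∫ x in (0 : ℝ)..1, x ^ (-(1 / 2 : ℝ)) * x ^ k = 1 / (k + 1 / 2) := by
  have heq : ∀ x ∈ Set.uIoc (0 : ℝ) 1, x ^ (-(1 / 2 : ℝ)) * x ^ k = x ^ ((k : ℝ) - 1 / 2) := by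
    intro x hx
    rw [uIoc_of_le zero_le_one] at hx
    rw [← Real.rpow_natCast, ← Real.rpow_add hx.1]
    ring_nf
  rw [integral_congr_ae' (Filter.Eventually.of_forall fun x hx => heq x (by rwa [uIoc_of_le zero_le_one]))
    (Filter.Eventually.of_forall fun x hx => by simp at hx)]
  rw [integral_rpow (Or.inl (by linarith [k.cast_nonneg (α := ℝ)]))]
  have hk : (k : ℝ) - 1 / 2 + 1 ≠ 0 := by
    have := k.cast_nonneg (α := ℝ); linarith
  rw [Real.zero_rpow hk, Real.one_rpow, show (k : ℝ) - 1 / 2 + 1 = k + 1 / 2 by ring]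
  norm_num

/-- The moments `x^{-1/2} x^k` are interval-integrable on `[0, 1]`. [cite: DavisRabinowitz1984, Sect. 1.10 (1.10.2)] -/
theorem intervalIntegrable_moment_rpow_neg_half (k : ℕ) :
    IntervalIntegrable (fun x : ℝ => x ^ (-(1 / 2 : ℝ)) * x ^ k) volume 0 1 := by
  have h : IntervalIntegrable (fun x : ℝ => x ^ ((k : ℝ) - 1 / 2)) volume 0 1 :=
    intervalIntegral.intervalIntegrable_rpow' (by have := k.cast_nonneg (α := ℝ); linarith)
  refine h.congr fun x hx => ?_
  rw [uIoc_of_le zero_le_one] at hx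
  rw [← Real.rpow_natCast, ← Real.rpow_add hx.1]
  ring_nf

/-- **The book's example**: `w(x) = x^{-1/2}` is an admissible weight on `[0, 1]` — nonnegative, `∫ = 2 > 0`, all moments
finite. [cite: DavisRabinowitz1984, Sect. 1.10 (1.10.2)] -/
theorem isAdmissibleWeight_rpow_neg_half : IsAdmissibleWeight (fun x : ℝ => x ^ (-(1 / 2 : ℝ))) 0 1 := by
  refine ⟨fun x hx => Real.rpow_nonneg hx.1 _, ?_, intervalIntegrable_moment_rpow_neg_half⟩
  rw [integral_rpow_neg_half_unit]; norm_num

/-- Its normalized form (1.10.1) is `x^{-1/2}/2`: `∫_0^1 x^{-1/2}/2 dx = 1`. [cite: DavisRabinowitz1984, Sect. 1.10 (1.10.1)] -/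
theorem isNormalizedWeight_rpow_neg_half_div_two : IsNormalizedWeight (fun x : ℝ => x ^ (-(1 / 2 : ℝ)) / 2) 0 1 := by
  unfold IsNormalizedWeight
  rw [intervalIntegral.integral_div, integral_rpow_neg_half_unit]
  norm_num

/-! ## The weighted-average reading -/

/-- For a normalized weight, nonnegative on `[a, b]` (`a ≤ b`), and `m ≤ f ≤ M` on `[a, b]` with `w f` integrable:
`m ≤ ∫_a^b w f ≤ M` — `∫ w f` is a weighted average of `f`. [cite: DavisRabinowitz1984, Sect. 1.10 (1.10.1)] -/
theorem weightedAverage_mem_Icc {w f : ℝ → ℝ} {a b m M : ℝ} (hab : a ≤ b) (hw : IntervalIntegrable w volume a b)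
    (hn : IsNormalizedWeight w a b) (h0 : ∀ x ∈ Icc a b, 0 ≤ w x) (hwf : IntervalIntegrable (fun x => w x * f x) volume a b)
    (hm : ∀ x ∈ Icc a b, m ≤ f x) (hM : ∀ x ∈ Icc a b, f x ≤ M) :
    (∫ x in a..b, w x * f x) ∈ Icc m M := by
  have h1 : ∫ x in a..b, w x * m ≤ ∫ x in a..b, w x * f x :=
    intervalIntegral.integral_mono_on hab (hw.mul_const m) hwf fun x hx =>
      mul_le_mul_of_nonneg_left (hm x hx) (h0 x hx)
  have h2 : ∫ x in a..b, w x * f x ≤ ∫ x in a..b, w x * M :=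
    intervalIntegral.integral_mono_on hab hwf (hw.mul_const M) fun x hx =>
      mul_le_mul_of_nonneg_left (hM x hx) (h0 x hx)
  rw [intervalIntegral.integral_mul_const, hn, one_mul] at h1 h2
  exact ⟨h1, h2⟩

end Literature.Analysis.Quadrature

end
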